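import Mathlib
import Literature.MathematicalPhysics.KineticTheory.FouriersLaw
import Summits.AtomisticToContinuum.FouriersLaw.Theorems.JunctionLocalitySuperadditiveResistanceStubDeviceForwardFieldsAux5

/-!
# Density in `L²(μ)` of a subspace with trivial orthogonal complement

Helper (`--supports`) for the line `bath-bond-deficit-integral` of the crux
`BondHeatUncertainty.SubdiffusiveBondHeat` (stmt-AtomisticToContinuum-9120): the registered stub
`stub_denseOfOrthogonal` of the lead's skeleton.

The lead needs "`(λ − L) C_c^∞` is `L²(μ_T)`-dense" in APPROXIMATION form, while the PDE argument
gives it in ORTHOGONALITY form (every `L²` function orthogonal to the subspace vanishes). This file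
is the abstract Hilbert-space bridge, for an arbitrary measure `μ` on a measurable space `α`
(specialised at the end to phase space `PhaseSpace N`): if `S` is a linear subspace of
square-integrable functions `α → ℝ` such that every measurable square-integrable `k` with
`∫ g k dμ = 0` for all `g ∈ S` vanishes `μ`-a.e., then every square-integrable `h` is
approximated by elements of `S` in mean square: `∀ ε > 0, ∃ g ∈ S, ∫ (h - g)² dμ ≤ ε`.

Proof: let `K ≤ L²(μ)` (`MeasureTheory.Lp ℝ 2 μ`, a real Hilbert space) be the subspace of classes
a.e. equal to an element of `S`. For `u ∈ Kᗮ` the canonical representative `⇑u` is (strongly)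
measurable and square-integrable, and `⟪toLp g, u⟫ = ∫ g ⇑u dμ = 0` for `g ∈ S`, so `⇑u = 0`
a.e., i.e. `u = 0`; hence `Kᗮ = ⊥`, so `K` is dense (`Submodule.topologicalClosure_eq_top_iff`),
and an element of `K` at `L²`-distance `< √ε` from `toLp h` is `toLp g` for some `g ∈ S` with
`∫ (h - g)² dμ = ‖toLp h - toLp g‖² < ε`. Finiteness of `μ` and measurability of `h` (present in
the registered signature) are not used. The `L²` bookkeeping `⟪toLp f, v⟫ = ∫ f v dμ`,
`‖toLp f‖² = ∫ f² dμ` is imported (`inner_toLp_left`, `norm_toLp_sq` of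
`…JunctionLocalitySuperadditiveResistanceStubDeviceForwardFieldsAux5`).
-/

noncomputable section

open MeasureTheory Filter

namespace Summit.AtomisticToContinuum.FouriersLaw.Theorems.SubdiffusiveBondHeat

open Literature.MathematicalPhysics.KineticTheory.HeatConduction
open Summit.AtomisticToContinuum.FouriersLaw.Cruxes.SuperadditiveResistance.FloatingProbeBypassLaplacian
  (inner_toLp_left norm_toLp_sq)

section L2

variable {α : Type*} [MeasurableSpace α] {μ : Measure α}

/-- The classes in `L²(μ)` a.e. equal to an element of a linear subspace `S` of functions
`α → ℝ` form a linear subspace of `L²(μ)`. [folklore] -/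
theorem exists_submodule_l2_ae_eq_mem (S : Submodule ℝ (α → ℝ)) :
    ∃ K : Submodule ℝ (Lp ℝ 2 μ), ∀ v : Lp ℝ 2 μ, v ∈ K ↔ ∃ g ∈ S, (v : α → ℝ) =ᵐ[μ] g := by
  refine ⟨{ carrier := {v | ∃ g ∈ S, (v : α → ℝ) =ᵐ[μ] g}
            add_mem' := ?_
            zero_mem' := ⟨0, S.zero_mem, Lp.coeFn_zero _ _ _⟩
            smul_mem' := ?_ }, fun v => Iff.rfl⟩
  · rintro v w ⟨g, hg, hvg⟩ ⟨g', hg', hwg'⟩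
    exact ⟨g + g', S.add_mem hg hg', (Lp.coeFn_add v w).trans (hvg.add hwg')⟩
  · rintro c v ⟨g, hg, hvg⟩
    exact ⟨c • g, S.smul_mem c hg, (Lp.coeFn_smul c v).trans (hvg.const_smul c)⟩

/-- **Density from a trivial orthogonal complement, in mean square.** If `S` is a linear
subspace of square-integrable functions `α → ℝ` such that every measurable square-integrable `k`
with `∫ g k dμ = 0` for all `g ∈ S` vanishes a.e., then every square-integrable `h` is
approximated by `S` in mean square: `∀ ε > 0, ∃ g ∈ S, ∫ (h - g)² dμ ≤ ε`. (Riesz: a subspace of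
a Hilbert space is dense iff its orthogonal complement is trivial.) [folklore] -/
theorem exists_mem_integral_sub_sq_le_of_orthogonal_trivial {S : Submodule ℝ (α → ℝ)}
    (hS : ∀ g ∈ S, MemLp g 2 μ)
    (horth : ∀ k : α → ℝ, Measurable k → MemLp k 2 μ → (∀ g ∈ S, ∫ x, g x * k x ∂μ = 0) →
      k =ᵐ[μ] 0)
    {h : α → ℝ} (hh : MemLp h 2 μ) {ε : ℝ} (hε : 0 < ε) :
    ∃ g ∈ S, ∫ x, (h x - g x) ^ 2 ∂μ ≤ ε := by
  obtain ⟨K, hK⟩ := exists_submodule_l2_ae_eq_mem (μ := μ) S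
  -- the orthogonal complement of `K` in `L²(μ)` is trivial
  have hKorth : Kᗮ = ⊥ := by
    rw [Submodule.eq_bot_iff]
    intro u hu
    rw [Submodule.mem_orthogonal] at hu
    refine Lp.eq_zero_iff_ae_eq_zero.mpr ?_
    refine horth u (Lp.stronglyMeasurable u).measurable (Lp.memLp u) fun g hg => ?_
    rw [← inner_toLp_left (hS g hg)]
    exact hu _ ((hK _).mpr ⟨g, hg, (hS g hg).coeFn_toLp⟩)
  -- hence `K` is dense
  have hdense : Dense (K : Set (Lp ℝ 2 μ)) :=
    Submodule.dense_iff_topologicalClosure_eq_top.mpr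
      (Submodule.topologicalClosure_eq_top_iff.mpr hKorth)
  obtain ⟨v, hvK, hv⟩ := hdense.exists_dist_lt (hh.toLp h) (Real.sqrt_pos.mpr hε)
  obtain ⟨g, hg, hvg⟩ := (hK v).mp hvK
  refine ⟨g, hg, ?_⟩
  have hgv : (hS g hg).toLp g = v := Lp.ext (((hS g hg).coeFn_toLp).trans hvg.symm)
  have hint : ∫ x, (h x - g x) ^ 2 ∂μ = ‖hh.toLp h - v‖ ^ 2 := by
    rw [← hgv, ← MemLp.toLp_sub, norm_toLp_sq]
    simp only [Pi.sub_apply]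
  rw [hint, ← dist_eq_norm]
  have h2 : dist (hh.toLp h) v ^ 2 < Real.sqrt ε ^ 2 :=
    pow_lt_pow_left₀ hv dist_nonneg two_ne_zero
  rw [Real.sq_sqrt hε.le] at h2
  exact h2.le

end L2

/-- Registered stub `stub_denseOfOrthogonal` (line `bath-bond-deficit-integral`): for a finite
measure `μ` on phase space and a linear subspace `S` of measurable square-integrable functions
whose `L²(μ)`-orthogonal complement (tested on measurable square-integrable `k`, pairing
`∫ g k dμ`) is trivial, every measurable square-integrable `h` is approximated by `S` in mean
square: `∀ ε > 0, ∃ g ∈ S, ∫ (h - g)² dμ ≤ ε`. A specialisation of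
`exists_mem_integral_sub_sq_le_of_orthogonal_trivial`. [folklore] -/
theorem stub_denseOfOrthogonal : ∀ (N : ℕ) (μ : Measure (PhaseSpace N)) [IsFiniteMeasure μ]
    (S : Submodule ℝ (PhaseSpace N → ℝ)), (∀ g ∈ S, Measurable g ∧ MemLp g 2 μ) →
    (∀ k : PhaseSpace N → ℝ, Measurable k → MemLp k 2 μ → (∀ g ∈ S, ∫ x, g x * k x ∂μ = 0) → k =ᵐ[μ] 0) →
    ∀ h : PhaseSpace N → ℝ, Measurable h → MemLp h 2 μ → ∀ ε : ℝ, 0 < ε → ∃ g ∈ S, ∫ x, (h x - g x) ^ 2 ∂μ ≤ ε :=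
  fun _ _ _ _ hS horth _ _ hh _ hε =>
    exists_mem_integral_sub_sq_le_of_orthogonal_trivial (fun g hg => (hS g hg).2) horth hh hε

end Summit.AtomisticToContinuum.FouriersLaw.Theorems.SubdiffusiveBondHeat
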